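import Literature.NumberTheory.NumberFields.HerbrandStickelbergerDictionary
import Literature.NumberTheory.GaloisRepresentations.FrobeniusDivisionDensityProofs
import Literature.NumberTheory.GaloisRepresentations.InducedGaloisRep
import HarnessLib

/-!
# The Herbrand direction of Mazur–Wiles' Theorem 2 in the Frobenius-avatar currency, unconditionally: `IsDirichletAvatar K θ χ m`, `‖B_{1,χ⁻¹}‖_p = 1` ⟹ `#e_θ(ℤ_p ⊗ Cl K) = 1` (Lang Ch. 1 §3 Thm. 3.1 via Stickelberger; Frobenius density in the tree's unconditional form)

Topic `Literature/NumberTheory/NumberFields`, namespace `Literature.NumberTheory.NumberFields.HerbrandStickelberger`.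
THEOREMS ONLY (no definition, no named fact, no `sorry`; D-0014 ∕ D-0026: net debt 0). Sequel BY NAME of
`HerbrandStickelbergerDictionary.lean` (`classGroupChiComponent_eq_bot_of_norm_bernoulli_eq_one_stickelberger'`: the Herbrand
direction in the `Γ_ℚ`-dictionary currency `θ(τ̄) = χ(χ_f(τ))`) and of
`GaloisRepresentations/FrobeniusDivisionDensityProofs.lean` (`absoluteGaloisGroup.monoidHom_eq_of_frobenius'`: two homomorphisms
on `Γ_K`, continuous through an injective map to a Hausdorff space, agreeing at the Frobenius elements outside a finite set of
places, are equal — an UNCONDITIONAL substitute for the Chebotarev corollary, from Frobenius' density theorem of 1896).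

* `forall_absGaloisQuot_eq_of_isDirichletAvatar` — **the Frobenius dictionary `IsDirichletAvatar K θ χ m` (`θ(σ) = χ(ℓ)` for every
  arithmetic Frobenius `σ` at every prime of `K` above every `ℓ ∤ m`) implies the `Γ_ℚ`-dictionary `θ(τ̄) = χ(χ_f(τ))` for ALL
  `τ ∈ Γ_ℚ`** (`K/ℚ` Galois): the characters `τ ↦ θ(τ̄)` and `τ ↦ χ(χ_f(τ))`, `Γ_ℚ → ℚ_pˣ`, have open kernels and agree at the
  Frobenius elements above the primes `ℓ ∤ m·f` (`χ_f(Frob_ℓ) = ℓ`, tree `Rat.modNCyclotomicCharacter_of_isArithFrobAt`; the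
  restriction of a Frobenius is a Frobenius, tree `isArithFrobAt_absGaloisQuot`). (The converse, `Γ_ℚ`-dictionary ⟹ Frobenius
  dictionary, is the tree's `isDirichletAvatar_of_forall_absGaloisQuot`.)
* **`classGroupChiCard_eq_one_of_norm_generalizedBernoulli_eq_one_stickelberger`** — EXACTLY the signature of the consumers' lemma
  `Literature.NumberTheory.NumberFields.classGroupChiCard_eq_one_of_norm_generalizedBernoulli_eq_one`
  (`ImaginaryAbelianClassGroupOddPartBernoulli.lean`) with its first hypothesis
  `(h : MazurWiles1984.thm2_oddChiPart_classGroup_card_eq_pow_val_bernoulli)` DELETED: `p ≠ 2`, `K/ℚ` abelian with `p ∤ [K:ℚ]`,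
  `θ : Gal(K/ℚ) →* ℤ_pˣ`, `χ` primitive of conductor `f` with `IsDirichletAvatar K θ χ m`, `χ` odd, «`χ ≠ ω`» as
  `¬ (f = p ∧ ∀ a, …)`, `‖generalizedBernoulli 1 χ⁻¹‖ = 1` ⟹ `classGroupChiCard ℚ K p θ = 1`.

HONEST FRAMING: Stickelberger–Herbrand, not Mazur–Wiles; the named fact is untouched and keeps its debt. Typed for the BSD cell
`bsd-print-cfram` (crux `stmt-BirchSwinnertonDyer-20372`, Stub H, the EVEN/Kummer engine's root lemma). BSD is not proved by any of this.

## References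

* [Lang1990] S. Lang, *Cyclotomic Fields I and II*, GTM 121 (1990), Ch. 1 §3 Thm. 3.1, Cor. 3.
* [Washington1997] L. C. Washington, *Introduction to Cyclotomic Fields*, 2nd ed. (1997), Thm. 6.10, §6.3.
* [Solomon1990] D. Solomon, Ann. Inst. Fourier 40 (1990), §I p. 468, §II.2 p. 471 (`χ(n) = χ(σ_n)`), Rem. II.1 (a).
* [Marcus2018] D. A. Marcus, *Number Fields*, 2nd ed. (2018), Ch. 7, Exercise 12 (f) (Frobenius density for subgroups).
-/

noncomputable section

namespace Literature.NumberTheory.NumberFields.HerbrandStickelberger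

open Literature.NumberTheory.GaloisRepresentations Field _root_.NumberField IsDedekindDomain
open Literature.NumberTheory.EllipticCurves Literature.NumberTheory.LFunctions

variable {K : Type} [Field K] [NumberField K] [IsGalois ℚ K] {p : ℕ} [Fact p.Prime] {f : ℕ} [NeZero f]

/-- A homomorphism with open kernel is locally constant. [folklore] -/
private theorem isLocallyConstant_of_isOpen_ker {Γ G : Type*} [Group Γ] [TopologicalSpace Γ]
    [ContinuousMul Γ] [Group G] (r : Γ →* G) (h : IsOpen (r.ker : Set Γ)) :
    IsLocallyConstant r := by
  refine (IsLocallyConstant.iff_exists_open r).2 fun σ => ⟨{τ | σ⁻¹ * τ ∈ r.ker}, ?_, ?_, ?_⟩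
  · exact h.preimage (continuous_const_mul σ⁻¹)
  · show σ⁻¹ * σ ∈ r.ker
    rw [inv_mul_cancel]; exact r.ker.one_mem
  · intro τ hτ
    have hτ' : r (σ⁻¹ * τ) = 1 := hτ
    rw [map_mul, map_inv, inv_mul_eq_one] at hτ'
    exact hτ'.symm

omit [IsGalois ℚ K] in
/-- `Γ_ℚ → Gal(K/ℚ)` has open kernel (`= res(Γ_K)`). [folklore] -/
private theorem isOpen_ker_absGaloisQuot [Normal ℚ K] :
    IsOpen (((absGaloisQuot ℚ K).ker : Subgroup (absoluteGaloisGroup ℚ)) : Set (absoluteGaloisGroup ℚ)) := by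
  have h : (((absGaloisQuot ℚ K).ker : Subgroup (absoluteGaloisGroup ℚ)) : Set (absoluteGaloisGroup ℚ)) =
      Set.range (absGaloisRestrict ℚ K) := by
    ext τ
    rw [SetLike.mem_coe, MonoidHom.mem_ker, absGaloisQuot_eq_one_iff]
    rfl
  rw [h]
  exact isOpen_range_absGaloisRestrict ℚ K

/-- A residue characteristic for a finite place of `ℚ`: a prime `ℓ` with `ℓ ∈ v`. [folklore] -/
private theorem exists_prime_natCast_mem (v : HeightOneSpectrum (𝓞 ℚ)) :
    ∃ ℓ : ℕ, ℓ.Prime ∧ (ℓ : 𝓞 ℚ) ∈ v.asIdeal := by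
  haveI : v.asIdeal.IsMaximal := v.isPrime.isMaximal v.ne_bot
  letI := Ideal.Quotient.field v.asIdeal
  haveI : Finite (𝓞 ℚ ⧸ v.asIdeal) := Ring.HasFiniteQuotients.finiteQuotient v.ne_bot
  refine ⟨ringChar (𝓞 ℚ ⧸ v.asIdeal), CharP.prime_ringChar _, ?_⟩
  rw [← Ideal.Quotient.eq_zero_iff_mem, map_natCast]
  exact ringChar.Nat.cast_ringChar

/-- **The Frobenius dictionary gives the `Γ_ℚ`-dictionary**: if `θ(σ) = χ(ℓ)` for every arithmetic Frobenius
`σ ∈ Gal(K/ℚ)` at every prime of `K` above every `ℓ ∤ m` (`IsDirichletAvatar K θ χ m`), then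
`θ(τ̄) = χ(χ_f(τ))` for EVERY `τ ∈ Γ_ℚ` — both sides are continuous homomorphisms `Γ_ℚ → ℚ_pˣ` agreeing
at the Frobenius elements above the primes `ℓ ∤ m·f` (`χ_f(Frob_ℓ) = ℓ`), hence equal by the tree's
unconditional Frobenius-density substitute `absoluteGaloisGroup.monoidHom_eq_of_frobenius'`.
[cite: Solomon1990, §II.2 p. 471 (χ(n) = χ(σ_n), the Artin map)] [cite: Marcus2018, Ch. 7, Exercise 12 (f)] -/
theorem forall_absGaloisQuot_eq_of_isDirichletAvatar (θ : (K ≃ₐ[ℚ] K) →* ℤ_[p]ˣ)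
    (χ : DirichletCharacter ℚ_[p] f) (m : ℕ) (hθχ : IsDirichletAvatar K θ χ m) :
    ∀ τ : absoluteGaloisGroup ℚ,
      (((θ (absGaloisQuot ℚ K τ) : ℤ_[p]ˣ) : ℤ_[p]) : ℚ_[p]) =
        χ ((modNCyclotomicCharacter ℚ f τ : (ZMod f)ˣ) : ZMod f) := by
  obtain ⟨hm0, hdict⟩ := hθχ
  -- the two characters `Γ_ℚ → ℚ_pˣ`
  let χ₁ : absoluteGaloisGroup ℚ →* ℚ_[p]ˣ :=
    (Units.map (PadicInt.Coe.ringHom (p := p)).toMonoidHom).comp (θ.comp (absGaloisQuot ℚ K))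
  let χ₂ : absoluteGaloisGroup ℚ →* ℚ_[p]ˣ := (MulChar.toUnitHom χ).comp (modNCyclotomicCharacter ℚ f)
  have hχ₁ : ∀ τ, ((χ₁ τ : ℚ_[p]ˣ) : ℚ_[p]) = (((θ (absGaloisQuot ℚ K τ) : ℤ_[p]ˣ) : ℤ_[p]) : ℚ_[p]) :=
    fun τ => rfl
  have hχ₂ : ∀ τ, ((χ₂ τ : ℚ_[p]ˣ) : ℚ_[p]) = χ ((modNCyclotomicCharacter ℚ f τ : (ZMod f)ˣ) : ZMod f) :=
    fun τ => MulChar.coe_toUnitHom χ _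
  suffices h : χ₁ = χ₂ by
    intro τ
    rw [← hχ₁, ← hχ₂, h]
  -- the finite set of places dividing `m·f`
  have hmf0 : Ideal.span {((m * f : ℕ) : 𝓞 ℚ)} ≠ 0 := by
    rw [Ne, Ideal.zero_eq_bot, Ideal.span_singleton_eq_bot]
    exact_mod_cast Nat.mul_ne_zero hm0.ne' (NeZero.ne f)
  refine absoluteGaloisGroup.monoidHom_eq_of_frobenius' (f := (Units.val : ℚ_[p]ˣ → ℚ_[p]))
    Units.val_injective (Ideal.finite_factors hmf0) ?_ ?_ ?_
  · -- continuity of `χ₁`: it factors through `Γ_ℚ → Gal(K/ℚ)` (open kernel)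
    have hloc := isLocallyConstant_of_isOpen_ker (absGaloisQuot ℚ K) (isOpen_ker_absGaloisQuot (K := K))
    exact (hloc.comp (fun g => ((Units.map (PadicInt.Coe.ringHom (p := p)).toMonoidHom (θ g) : ℚ_[p]ˣ) :
      ℚ_[p]))).continuous
  · -- continuity of `χ₂`: the cyclotomic character has open kernel
    have hloc := isLocallyConstant_of_isOpen_ker (modNCyclotomicCharacter ℚ f)
      (Subgroup.isOpen_of_mem_nhds _ (modNCyclotomicCharacter_eventually_eq_one ℚ f))
    exact (hloc.comp (fun u : (ZMod f)ˣ => ((MulChar.toUnitHom χ u : ℚ_[p]ˣ) : ℚ_[p]))).continuous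
  · -- agreement at the Frobenius elements above `ℓ ∤ m f`
    intro v hv 𝔓 h𝔓 Φ hΦ
    haveI : 𝔓.IsPrime := h𝔓.1
    obtain ⟨ℓ, hℓ, hℓv⟩ := exists_prime_natCast_mem v
    have hℓmf : ¬ ℓ ∣ m * f := by
      intro hdvd
      apply hv
      rw [Set.mem_setOf_eq, Ideal.dvd_span_singleton]
      obtain ⟨c, hc⟩ := hdvd
      rw [hc, Nat.cast_mul]
      exact v.asIdeal.mul_mem_right _ hℓv
    have hℓm : ¬ ℓ ∣ m := fun h => hℓmf (dvd_mul_of_dvd_left h _)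
    have hℓf : ¬ ℓ ∣ f := fun h => hℓmf (dvd_mul_of_dvd_right h _)
    -- the prime `𝔓 ∩ 𝓞 K` of `K` and the restricted Frobenius
    have hℓ𝔓 : ((ℓ : ℕ) : absIntegers (𝓞 ℚ) ℚ) ∈ 𝔓 := by
      have h := Ideal.mem_comap.mp (h𝔓.2.over ▸ hℓv : (ℓ : 𝓞 ℚ) ∈ 𝔓.under (𝓞 ℚ))
      rwa [map_natCast] at h
    have hℓw : (ℓ : 𝓞 K) ∈ 𝔓.comap (absEmbeddingInt ℚ K) := by
      rw [Ideal.mem_comap, map_natCast]; exact hℓ𝔓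
    have hw0 : 𝔓.comap (absEmbeddingInt ℚ K) ≠ ⊥ := by
      intro h0
      rw [h0, Ideal.mem_bot] at hℓw
      exact hℓ.ne_zero (by exact_mod_cast hℓw)
    let w : HeightOneSpectrum (𝓞 K) := ⟨𝔓.comap (absEmbeddingInt ℚ K), Ideal.IsPrime.comap _, hw0⟩
    have hσ : IsArithFrobAt ℤ (absGaloisQuot ℚ K Φ) w.asIdeal := isArithFrobAt_absGaloisQuot K hℓ hℓv h𝔓 hΦ
    have h1 := hdict ℓ hℓ hℓm w hℓw (absGaloisQuot ℚ K Φ) hσ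
    refine Units.ext ?_
    rw [hχ₁, hχ₂, h1, Rat.modNCyclotomicCharacter_of_isArithFrobAt hℓ hℓf hℓv h𝔓 hΦ]

omit [IsGalois ℚ K] in
/-- **The Herbrand direction of Mazur–Wiles' Theorem 2 in the Frobenius-avatar currency, unconditionally
(drop-in twin of `classGroupChiCard_eq_one_of_norm_generalizedBernoulli_eq_one` of
`ImaginaryAbelianClassGroupOddPartBernoulli.lean` WITHOUT the hypothesis
`(h : MazurWiles1984.thm2_oddChiPart_classGroup_card_eq_pow_val_bernoulli)`).** For `p` odd, `K/ℚ` abelian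
with `p ∤ [K:ℚ]`, `θ : Gal(K/ℚ) → ℤ_pˣ` with primitive odd `ℚ_p`-valued Dirichlet avatar `χ` mod `f`
(`IsDirichletAvatar K θ χ m`), «`χ ≠ ω`» and `‖B_{1,χ⁻¹}‖_p = 1`: `#e_θ(ℤ_p ⊗ Cl K) = 1`. (The Frobenius dictionary
is turned into the `Γ_ℚ`-dictionary by `forall_absGaloisQuot_eq_of_isDirichletAvatar`; then
`classGroupChiComponent_eq_bot_of_norm_bernoulli_eq_one_stickelberger`.)
[cite: Lang1990, Ch. 1 §3 Thm. 3.1 and Cor. 3] [cite: Washington1997, Thm. 6.10] [cite: Solomon1990, §I p. 468, Rem. II.1 (a)] -/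
theorem classGroupChiCard_eq_one_of_norm_generalizedBernoulli_eq_one_stickelberger [IsAbelianGalois ℚ K]
    (hp : p ≠ 2) (hK : ¬ p ∣ Module.finrank ℚ K) (θ : (K ≃ₐ[ℚ] K) →* ℤ_[p]ˣ)
    (χ : DirichletCharacter ℚ_[p] f) (m : ℕ) (hχ : χ.IsPrimitive) (hθχ : IsDirichletAvatar K θ χ m)
    (hodd : χ.Odd) (hω : ¬ (f = p ∧ ∀ a : ℤ, ¬ ((p : ℤ) ∣ a) → ‖χ (a : ZMod f) - (a : ℚ_[p])‖ < 1))
    (hB : ‖(generalizedBernoulli 1 χ⁻¹ : ℚ_[p])‖ = 1) :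
    classGroupChiCard ℚ K p (fun g => ((θ g : ℤ_[p]ˣ) : ℤ_[p])) = 1 := by
  have hψχ := forall_absGaloisQuot_eq_of_isDirichletAvatar θ χ m hθχ
  have hB' : ‖KrizLi2019.bernoulliOnePrim χ⁻¹‖ = 1 := by
    rw [bernoulliOnePrim_inv_eq_generalizedBernoulli hχ]; exact hB
  have hbot := classGroupChiComponent_eq_bot_of_norm_bernoulli_eq_one_stickelberger' (K := K) hp hK hχ hodd
    hω hψχ hB'
  unfold classGroupChiCard
  rw [hbot]
  exact Nat.card_unique

end Literature.NumberTheory.NumberFields.HerbrandStickelberger
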